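import Summits.ValiantsHypothesis.ValiantsHypothesis.Theorems.GrenetZeonAbelianizationQPGorenstein
import Summits.ValiantsHypothesis.ValiantsHypothesis.Theorems.GrenetZeonPolySizeQPAlgebraSumsOfDeterminants
import HarnessLib

/-!
# The crux `AbelianizationQP` (stmt-ValiantsHypothesis-8063) in Gorenstein normal form

Helper file for the crux `AbelianizationQP` of route `GrenetZeon` (line `zeon-window`; open stub
`stub_subexpAbelianization` ≡ the crux).  The crux asks: from every affine determinantal expression
of `per_n` of size `m`, produce an `(n^c + c, 2^((log₂ m + c)^c))`-representation over SOME
commutative coefficient algebra.  By the local Frobenius decomposition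
(`exists_local_frobenius_decomposition`, file `GrenetZeonAbelianizationQPGorenstein.lean`) and
additivity (`hasAlgDetRepr_finset_sum`), the crux is EQUIVALENT to its Gorenstein normal form:

  `∃ c, ∀ n ≥ 1, ∀ m`, every determinantal expression of `per_n` of size `m` yields
  `per_n = Σ_{i<t} fᵢ`, `t ≤ Q`, `Σ dim Rᵢ ≤ Q` (`Q = 2^((log₂ m + c)^c)`), where each
  `fᵢ = λᵢ(det Aᵢ)` for an affine matrix `Aᵢ` of size `n^c + c` over a LOCAL coefficient algebra
  `Rᵢ` (character `φᵢ`, `(ker φᵢ)^Q = 0`) read through a NONDEGENERATE functional `λᵢ` — a local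
  Frobenius = Gorenstein pair, i.e. (Macaulay) the apolar algebra of one polynomial read at its
  socle (`apply_ne_zero_of_socle`, `socle_smul_comm`).

So a re-lining of the crux may target, without loss, sums of apolar algebras of single
polynomials `F₁, …, F_t` with `Σ dim ≤ 2^(polylog m)` — the common shape of the zeon point
(`F = y₁ ⋯ yₙ`) and of the Landsberg–Ressayre point (`F = det_n`).

## Main result

* `abelianizationQP_iff_localFrobenius` — the equivalence above.

No stub is closed; `VP ≠ VNP` is not touched.

## References

* P. Hrubeš, A. Yehudayoff, *Arithmetic complexity in ring extensions*, Theory of Computing 7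
  (2011), §2. [cite: HrubesYehudayoff2011, §2]
-/

set_option linter.dupNamespace false

noncomputable section

namespace Summit.ValiantsHypothesis.ValiantsHypothesis.Theorems.GrenetZeonAbelianizationQP

open MvPolynomial Matrix
open Literature.Computability.AlgebraicComplexity
open Summit.ValiantsHypothesis.ValiantsHypothesis.Theses.GrenetZeon
open Summit.ValiantsHypothesis.ValiantsHypothesis.Theorems.GrenetZeonPolySizeQPAlgebra

/-- **`AbelianizationQP` ⟺ its Gorenstein (local Frobenius) normal form.** `→`: decompose the
witness representation (`exists_local_frobenius_decomposition`).  `←`: each local summand `fᵢ` is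
an `(n^c + c, dim Rᵢ)`-representation (`HasAlgDetRepr.of_data`), their sum an
`(n^c + c, Σ dim Rᵢ)`-representation (`hasAlgDetRepr_finset_sum`), padded to
`2^((log₂ m + c)^c)` (`HasAlgDetRepr.mono`). [cite: HrubesYehudayoff2011, §2] -/
theorem abelianizationQP_iff_localFrobenius :
    AbelianizationQP ↔
      ∃ c : ℕ, ∀ n m : ℕ, 1 ≤ n → HasDetRepr (perPoly (Fin n) ℂ) m →
        ∃ (t : ℕ) (F : Fin t → MvPolynomial (Fin n × Fin n) ℂ) (dim : Fin t → ℕ),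
          t ≤ 2 ^ ((Nat.log 2 m + c) ^ c) ∧ ∑ i, dim i ≤ 2 ^ ((Nat.log 2 m + c) ^ c) ∧
            perPoly (Fin n) ℂ = ∑ i, F i ∧
              ∀ i, ∃ (Rᵢ : Type) (_ : CommRing Rᵢ) (_ : Algebra ℂ Rᵢ) (_ : Module.Finite ℂ Rᵢ)
                (φ : Rᵢ →ₐ[ℂ] ℂ), RingHom.ker (φ : Rᵢ →+* ℂ) ^ (2 ^ ((Nat.log 2 m + c) ^ c)) = ⊥ ∧
                  Module.finrank ℂ Rᵢ = dim i ∧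
                    ∃ (lᵢ : Rᵢ →ₗ[ℂ] ℂ)
                      (Aᵢ : Matrix (Fin (n ^ c + c)) (Fin (n ^ c + c))
                        (MvPolynomial (Fin n × Fin n) Rᵢ)),
                      (∀ a b, (Aᵢ a b).totalDegree ≤ 1) ∧
                        (∀ d : (Fin n × Fin n) →₀ ℕ,
                          lᵢ (coeff d Aᵢ.det) = coeff d (F i)) ∧
                          ∀ r : Rᵢ, (∀ x, lᵢ (x * r) = 0) → r = 0 := by
  constructor
  · rintro ⟨c, hc⟩
    refine ⟨c, fun n m hn hdet => ?_⟩
    have h : HasAlgDetRepr (perPoly (Fin n) ℂ) (n ^ c + c) (2 ^ ((Nat.log 2 m + c) ^ c)) :=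
      hc n m hn hdet
    exact exists_local_frobenius_decomposition h
  · rintro ⟨c, hc⟩
    refine ⟨c, fun n m hn hdet => ?_⟩
    obtain ⟨t, F, dim, _ht, hsum, hper, hloc⟩ := hc n m hn hdet
    have hF : ∀ i ∈ (Finset.univ : Finset (Fin t)), HasAlgDetRepr (F i) (n ^ c + c) (dim i) := by
      intro i _
      obtain ⟨Rᵢ, _, _, _, φ, -, hdim, lᵢ, Aᵢ, hA, hf, -⟩ := hloc i
      exact HasAlgDetRepr.of_data Rᵢ hdim.le lᵢ Aᵢ hA hf
    have h := hasAlgDetRepr_finset_sum Finset.univ F (n ^ c + c) dim hF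
    rw [← hper] at h
    exact h.mono le_rfl hsum

end Summit.ValiantsHypothesis.ValiantsHypothesis.Theorems.GrenetZeonAbelianizationQP

end
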